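import Summits.BirchSwinnertonDyer.BirchSwinnertonDyer.Theorems.AdditiveKolyvaginRoadKolyvaginPrimitiveOfIndexLowerBound
import Summits.BirchSwinnertonDyer.BirchSwinnertonDyer.Theorems.AdditiveKolyvaginRoadLevelKolyvaginSystemsAdditivePoitouTateFree
import Summits.BirchSwinnertonDyer.BirchSwinnertonDyer.Theorems.AdditiveKolyvaginRoadAdditiveKolyvaginKernel
import Summits.BirchSwinnertonDyer.BirchSwinnertonDyer.Theorems.AdditiveBranchIMCGordTwoRankOneHeegnerKolyvaginUpper
import Summits.BirchSwinnertonDyer.Rank1Residual.X11b.BDPRouteRigidity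
import Summits.BirchSwinnertonDyer.Rank1Residual.X11b.CastellaErratumTwistUnits
import Summits.BirchSwinnertonDyer.Rank1Residual.X11b.Three.StepLAtThree
import Summits.BirchSwinnertonDyer.Rank1Residual.X2.TwistTamagawa
import Literature.NumberTheory.EllipticCurves.GlobalMinimalModelProofs
import HarnessLib

/-!
# Route `AdditiveKolyvaginRoad`: KOLYVAGIN'S CONJECTURE MOD `p` AT AN ADDITIVE ♯ FRAME FROM THE LOWER (EISENSTEIN)
# HALVES OF `BSD_p` OVER `ℚ` — the landing socket of every Eisenstein-congruence engine on the cruxes KS′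
# (`LevelKolyvaginSystemsAdditive`, item stmt-BirchSwinnertonDyer-21396) and KPA′ (`KolyvaginPrimitiveAdditive`, item 21400)
# (cell `pub/bsd-wall`, width seat `bsd-wall-akr-p2x-w5` g6; `--supports stmt-BirchSwinnertonDyer-21396`, helper)

THEOREMS ONLY (no definition, no named fact, no `sorry`); nothing about Kolyvagin's conjecture and nothing about any `p`-part of
BSD is asserted — every half of `BSD_p` and every published input below is a HYPOTHESIS.  BSD is not proved by any of this;
KS′ and KPA′ stay OPEN at `p² ∣ N`.

THE POINT.  The line of record of crux KS′ (`Cruxes/LevelKolyvaginSystemsAdditive/Lines/epsilon_matched_retyping.lean`, v15)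
is deflated to ONE stub `stub_kolyvaginPrimitiveAboveBottom` = KPA′'s conclusion («some mod-`p` Kolyvagin class `c(n)` of
Kolyvagin-prime support is non-zero») at the ♯ frames where the bottom class vanishes — Kolyvagin's conjecture mod `p` above
the bottom at an additive `p ≥ 5`, research.  The crux-ideation cards that attack it by an EISENSTEIN CONGRUENCE over `ℚ` or over
auxiliary fields (`Ideas/parahoric-ordinary-type-engine.md`, `hsieh-mu-direct`, `bdp-rebase` S5 …) all end in the same currency:
the LOWER («main-conjecture ∕ Eisenstein») half of `BSD_p` over `ℚ`, `ord_p #Ш(E)_an ≤ ord_p #Ш(E)` (`Typed.MissingLowerBoundAt`),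
for `E` (analytic rank `1`) and for its Heegner twist `E^{(d_K)}` (analytic rank `0`); the newest card types the passage from there
to the crux as a «glue target» (`ParahoricOrdinaryTypeEngineSketch.SocketOverQ`).  That passage is ALREADY in the tree piecewise —
multr1-p2's Gross–Zagier bookkeeping `X11b.indexLowerBoundAt_of_missingLowerBoundAt` (one-sided halves over `ℚ` ⟹ STEP L
`X11b.IndexLowerBoundAt` over `K`), the additive-`p` transports `X11b.padicValRat_u_eq_zero_of_twist_minimal_of_splitsIn` and
`X2.padicValNat_tamagawaProduct_twist_of_heegner_of_odd`, the rank-zero currency conversion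
`AdditiveBranchIMCGordTwoRankOne.HeegnerKolyvagin.twist_ge_half_of_missingLowerBoundAt`, and width seat akr-p2x-w2's
`exists_kolyvaginClass_ne_zero_of_indexLowerBoundAt` (STEP L at the frame's Heegner points ⟹ a non-zero mod-`p` Kolyvagin class,
McCallum 1991 §5 read backwards) — and is COMPOSED here, in the crux's own binders:

* §1 `exists_kolyvaginClass_ne_zero_of_lowerHalves` — ONE ♯ frame `(W, p ≥ 5 additive, K, Dt, β, ι)` (the binders of KPA′ ∕ of
  `stub_kolyvaginPrimitiveAboveBottom` that are used: `ρ̄_{E,p}` onto, non-CM, `p ∤ ∏ c_ℓ`, `r_an = 1`, `d_K` odd `< −4`, Heegner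
  hypothesis, `L(E^{(d_K)},1) ≠ 0`, `4N ∣ β² − d_K`, `p ∤ c(Dt)`): the two LOWER halves `Typed.MissingLowerBoundAt W p` and
  `Typed.MissingLowerBoundAt Wd p` for the globally minimal models `Wd = Cd • E^{(d_K)}` of the twist, granted Gross–Zagier,
  Kolyvagin and his index bound, GZK, modularity and McCallum's Cor. 5.6 divisibility half (named facts, binders), give a
  Kolyvagin–Heegner datum `d` at a Kolyvagin level `n` with `d.kolyvaginClass _ 1 ≠ 0` — VERBATIM the conclusion of KPA′ and of
  `stub_kolyvaginPrimitiveAboveBottom` at the frame (whose extra «above the bottom» binder is simply not needed).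
* §2 `kolyvaginPrimitiveAdditive_of_lowerHalves` — CLASS LEVEL against the route's decls:
  `PublishedInputsAdditiveKoly → (McCallum divisibility half) → LOW₀ → LOW₁ → KolyvaginPrimitiveAdditive`, where
  LOW₀ := «the LOWER half of `BSD_p` at every non-CM additive analytic-rank-`0` row at `p ≥ 5`» (the binders of the route's
  `RankZeroAdditive` VERBATIM, conclusion weakened from `BSDp` to `Typed.MissingLowerBoundAt`; it feeds the twist, which is
  non-CM, additive at `p` and of analytic rank `0` by `AdditiveKolyvaginKernel.twist_nonCM_addv_rankZero`) and
  LOW₁ := «the LOWER half of `BSD_p` at every ♯ additive analytic-rank-`1` row» (the binders of the kernel's conclusion VERBATIM,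
  again with `Typed.MissingLowerBoundAt` for `BSDp`).  So crux r2 carries NO SURPLUS over the EISENSTEIN HALF of what the route's
  kernel `AdditiveKolyvaginKernel` proves from it: modulo PUB, McCallum and LOW₀, KPA′ ⟸ LOW₁ (and the kernel gives KPA′ →
  RankZeroAdditive → `BSDp` ⊇ LOW₁ on the same rows).
* §3 `levelKolyvaginSystemsAdditive_of_lowerHalves` — the same for THIS crux KS′, through akr-p2x-w4's input-free door
  `levelKolyvaginSystemsAdditive_of_kolyvaginPrimitiveAdditive_free` (KPA′ → KS′ at the Poitou–Tate theorem).

Nothing here uses a reduction hypothesis at `p` beyond `p ∣ N` (so `p` splits in `K`): the socket is open to ANY engine that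
delivers the two lower halves over `ℚ` at an additive `p ≥ 5` — in print there is none at `p² ∣ N` (Skinner–Urban needs `p ∤ N`,
Skinner 2016 `p ∥ N`; Fouquet–Wan arXiv:2107.13726 only on its (Lgl) locus, unrefereed), which is why KS′ ∕ KPA′ stay OPEN.

References (locators only): [cite: JetchevSkinnerWan2017, §7.4.1 (eq:gz for K′), (eq:tamK), (eq:shalowerK-1), §7.4.3 (pp. 29–31)]
[cite: McCallumLMS1991, §1 Theorem (p. 296), §5 Lemma 5.1 and Cor. 5.6 (p. 310), §4 Cor. 4.5] [cite: GrossZagier1986, V.§2 (2.2)]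
[cite: Miller2011LMS, Def. 1.1] [cite: WZhang2014, Thm. 1.1, Remark 5, §9] [cite: GrossLMS1991, (1.1), Thm. 1.3, §4].
-/

-- single-conjunct summit: `Summit.BirchSwinnertonDyer.BirchSwinnertonDyer.…` repeats the name by design
set_option linter.dupNamespace false

set_option autoImplicit false

noncomputable section

open scoped Classical

namespace Summit.BirchSwinnertonDyer.BirchSwinnertonDyer.Theorems.AdditiveKoly

open WeierstrassCurve NumberField Field
  Literature.NumberTheory.EllipticCurves Literature.NumberTheory.EllipticCurves.ModularForms
  Literature.NumberTheory.EllipticCurves.Rank1Residual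
  Summit.BirchSwinnertonDyer.Rank1Residual Summit.BirchSwinnertonDyer.Rank1Residual.X11b
  Summit.BirchSwinnertonDyer.Rank1Residual.X11b.Three
  Summit.BirchSwinnertonDyer.BirchSwinnertonDyer.Theorems.AdditiveBranchIMCGordTwoRankOne
  Summit.BirchSwinnertonDyer.BirchSwinnertonDyer.Theses.AdditiveKolyvaginRoad

/-! ## §1 One ♯ frame: the two lower halves over `ℚ` force a non-zero mod-`p` Kolyvagin class -/

section Frame

-- `K : Type`: the tree's ring-class class field theory is universe `0` (as in the crux).
variable (W : WeierstrassCurve ℚ) [W.IsElliptic] [W.IsGloballyMinimal] [NeZero (W.conductorNorm ℤ)]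
  (p : ℕ) [hp : Fact p.Prime] (K : Type) [Field K] [NumberField K]
  (Dt : ModularParametrizationData W (W.conductorNorm ℤ)) (β : ℤ) (ι : K →+* ℂ)

/-- **KOLYVAGIN'S CONJECTURE MOD `p` AT ONE ADDITIVE ♯ FRAME FROM THE TWO LOWER HALVES OF `BSD_p` OVER `ℚ`.**  Data: `W/ℚ`
globally minimal elliptic, non-CM (`hCM`), `p ≥ 5` additive (`hadd`) with `ρ̄_{E,p}` onto, `p ∤ ∏ c_ℓ(E)`, `ord_{s=1} L(E,s) = 1`;
`K` imaginary quadratic with `d_K` odd, `d_K < −4`, the Heegner hypothesis for `N_E` and `L(E^{(d_K)},1) ≠ 0`; a frame `(Dt, β, ι)`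
with `4N_E ∣ β² − d_K` and `p ∤ c(Dt)`.  PUBLISHED inputs as binders: Gross–Zagier `hGZ`, Kolyvagin `hKo` and his index bound `hKoB`,
Gross–Zagier–Kolyvagin over `ℚ` `hGZK`, modularity `hmod`, McCallum's Cor. 5.6 divisibility half `hMc`.  HYPOTHESES (the engine's
output, Miller currency): the LOWER half of `BSD_p(E)` `hlow : Typed.MissingLowerBoundAt W p` (`ord_p #Ш(E)_an ≤ ord_p #Ш(E)`) and the
LOWER half of `BSD_p` for every globally minimal model `Wd = Cd • E^{(d_K)}` of the twist (`hlowTw`; `Wd` is non-CM, additive at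
`p`, of analytic rank `0`).  CONCLUSION: some Kolyvagin–Heegner datum `d` at some Kolyvagin level `n` (square-free product of
Zhang–Kolyvagin primes) has `d.kolyvaginClass _ 1 ≠ 0` in `H¹(K, E[p])` — the conclusion of KPA′ and of the line's stub
`stub_kolyvaginPrimitiveAboveBottom` at this frame.  Proof: `p ∣ N` splits in `K`, so `p ∤ d_K·#𝓞_K^×` and the minimal twist model
has `ord_p u(Cd) = 0`, `ord_p ∏c_ℓ(Wd) = ord_p ∏c_ℓ(W)`; the twist's lower half converts to the `≥`-half of its `L`-value
(`twist_ge_half_of_missingLowerBoundAt`); the Gross–Zagier bookkeeping `X11b.indexLowerBoundAt_of_missingLowerBoundAt` gives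
STEP L `2·ord_p [E(K):ℤP] ≤ ord_p #Ш(E/K) + 2·ord_p ∏c_ℓ` at every Heegner point `P` of the frame; and
`exists_kolyvaginClass_ne_zero_of_indexLowerBoundAt` (Kolyvagin's bound + McCallum Cor. 5.6 ∕ 4.5) turns STEP L into a non-zero
class.  CONDITIONAL on every binder; nothing is booked. [cite: JetchevSkinnerWan2017, §7.4.1 (eq:gz for K′), (eq:tamK), §7.4.3]
[cite: McCallumLMS1991, §5 Cor. 5.6 (p. 310) and §4 Cor. 4.5] [cite: Miller2011LMS, Def. 1.1] -/
theorem exists_kolyvaginClass_ne_zero_of_lowerHalves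
    -- published inputs (named facts of the tree)
    (hGZ : gross_zagier (W.conductorNorm ℤ) W K) (hKo : kolyvagin (W.conductorNorm ℤ) W K)
    (hKoB : Kolyvagin1990_padicValNat_card_sha_le (W.conductorNorm ℤ) W K)
    (hGZK : rank_eq_analyticRank_of_analyticRank_le_one) (hmod : hasEntireLFunction_rat)
    (hMc : McCallum1991_padicValNat_card_sha_primary_add_le_of_globalDivisibility)
    -- the frame (only the binders that are used)
    (hp5 : 5 ≤ p) (hadd : Addv W p) (hs : W.HasSurjectiveModNGaloisRep p) (hCM : ¬ W.HasCM)
    (htam : ¬ p ∣ W.tamagawaProduct) (hr : W.analyticRank = 1)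
    (hK : IsImaginaryQuadratic K) (hodd : Odd (NumberField.discr K)) (hlt : NumberField.discr K < -4)
    (hH : SatisfiesHeegnerHypothesis (W.conductorNorm ℤ) K)
    (hL : (W.quadraticTwist (NumberField.discr K : ℚ)).entireLFunction 1 ≠ 0)
    (hβ : (4 * (W.conductorNorm ℤ : ℤ)) ∣ β ^ 2 - NumberField.discr K) (hc : ¬ (p : ℤ) ∣ Dt.c)
    -- the two LOWER halves of `BSD_p` over `ℚ`: for `E` (rank one) and for the twist `E^{(d_K)}` (rank zero)
    (hlow : Typed.MissingLowerBoundAt W p)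
    (hlowTw : ∀ (Wd : WeierstrassCurve ℚ) [Wd.IsElliptic] [Wd.IsGloballyMinimal] (Cd : VariableChange ℚ),
      Cd • W.quadraticTwist (NumberField.discr K : ℚ) = Wd → Typed.MissingLowerBoundAt Wd p) :
    ∃ (n : ℕ) (d : KolyvaginHeegnerData Dt β ι n),
      KolyvaginDescent.KolSupp (Zhang2014.IsKolyvaginPrime (W.conductorNorm ℤ) W K p) n ∧
        d.kolyvaginClass hp.out 1 ≠ 0 := by
  have hpP : p.Prime := hp.out
  have hp2 : p ≠ 2 := by omega
  -- `p ∣ N` (additive) splits in `K`: `p ∤ d_K`, `p ∤ #𝓞_K^×`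
  have hpN : p ∣ W.conductorNorm ℤ :=
    (W.dvd_conductorNorm_iff_not_hasGoodReductionAtPrime p).mpr hadd.1
  have hpd : ¬ (p : ℤ) ∣ NumberField.discr K :=
    Literature.SatisfiesHeegnerHypothesis.not_dvd_discr hK.1 hH hpP hpN
  obtain ⟨-, hμ⟩ := not_dvd_discr_and_not_dvd_torsionOrder_of_heegner hK hH hp2 hpN
  -- a globally minimal model `Wd` of the twist `E^{(d_K)}`: `L(Wd,1) ≠ 0`, its lower half in the `≥`-shape
  have hD0 : (NumberField.discr K : ℚ) ≠ 0 := by exact_mod_cast NumberField.discr_ne_zero K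
  haveI hEt : (W.quadraticTwist (NumberField.discr K : ℚ)).IsElliptic := W.isElliptic_quadraticTwist hD0
  obtain ⟨Cd, hCd⟩ := hasGlobalMinimalModel_rat_holds (W.quadraticTwist (NumberField.discr K : ℚ))
  haveI := hCd
  set Wd : WeierstrassCurve ℚ := Cd • W.quadraticTwist (NumberField.discr K : ℚ) with hWd_def
  have hWd : Cd • W.quadraticTwist (NumberField.discr K : ℚ) = Wd := rfl
  have hLt' : (W.quadraticTwist (NumberField.discr K : ℚ)).entireLFunction = Wd.entireLFunction := by
    rw [← hWd, entireLFunction_smul]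
  have hLd1 : Wd.entireLFunction 1 ≠ 0 := by rw [← hLt']; exact hL
  obtain ⟨qd, hqd, hvqd⟩ :=
    HeegnerKolyvagin.twist_ge_half_of_missingLowerBoundAt hGZK hmod Wd p hLd1 (hlowTw Wd Cd hWd)
  -- the additive-`p` transports: Tamagawa products and the unit of the minimal twist model
  have htamEq : padicValNat p Wd.tamagawaProduct = padicValNat p W.tamagawaProduct :=
    X2.padicValNat_tamagawaProduct_twist_of_heegner_of_odd W p hp2 K hK hodd hpd hH Cd hWd
  have hu : padicValRat p (Cd.u : ℚ) = 0 :=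
    X11b.padicValRat_u_eq_zero_of_twist_minimal_of_splitsIn W p K hK.1 (hH p hpP hpN) Cd hWd
  -- STEP L at every Heegner point of the frame (Gross–Zagier bookkeeping over `K`)
  have hILB : ∀ (H : HeegnerDatum (W.conductorNorm ℤ) (NumberField.discr K))
      (P : (W.baseChange K).toAffine.Point), H.β = β →
      WeierstrassCurve.Affine.Point.map ι.toRatAlgHom P = heegnerPointComplex Dt H → ¬ IsOfFinAddOrder P →
      X11b.IndexLowerBoundAt W p K P := fun H P _ hP _ ↦
    indexLowerBoundAt_of_missingLowerBoundAt W p (W.conductorNorm ℤ) K Dt H ι P hGZ hKo hGZK hmod hK hH hP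
      hp2 hc hμ hr hL Wd Cd hWd hu htamEq ⟨qd, hqd, hvqd⟩ hlow
  -- STEP L ⟹ a non-zero mod-`p` Kolyvagin class (Kolyvagin's bound + McCallum Cor. 5.6 divisibility half + Cor. 4.5)
  exact exists_kolyvaginClass_ne_zero_of_indexLowerBoundAt W p K Dt β ι hGZ hKo hKoB hmod hMc hp5 hs hCM hr
    htam hK hlt hH hL hβ hILB

end Frame

/-! ## §2 Class level, against the route's decls: `PUB → McCallum → LOW₀ → LOW₁ → KPA′` -/

/-- **CRUX r2 `KolyvaginPrimitiveAdditive` FROM THE LOWER HALVES OF `BSD_p` OVER `ℚ`**, modulo the route's published inputs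
(`PublishedInputsAdditiveKoly`; only Gross–Zagier, Kolyvagin, Kolyvagin's bound, GZK and modularity are used) and McCallum's Cor. 5.6
divisibility half.  LOW₀ (`h₀`): the LOWER half `Typed.MissingLowerBoundAt W p` at every non-CM additive analytic-rank-`0` row at
`p ≥ 5` — the binders of `RankZeroAdditive` VERBATIM with the conclusion weakened from `BSDp W p` to its Eisenstein half; it feeds the
twist `E^{(d_K)}` (non-CM, additive at `p`, analytic rank `0`: `AdditiveKolyvaginKernel.twist_nonCM_addv_rankZero`).  LOW₁ (`h₁`): the
LOWER half at every ♯ additive analytic-rank-`1` row — the binders of the kernel `AdditiveKolyvaginKernel`'s conclusion VERBATIM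
(non-CM, `p ≥ 5`, `Addv`, `r_an = 1`, `ρ̄` onto, ♠(1), ♠(2), `p ∤ ∏ c_ℓ`), again with `Typed.MissingLowerBoundAt` for `BSDp`.
CONCLUSION: `KolyvaginPrimitiveAdditive` (§1 frame by frame; non-CM from a multiplicative prime ♠(2)).  So, modulo PUB, McCallum
and LOW₀, the crux KPA′ is implied by the EISENSTEIN HALF ALONE of `BSD_p` on the ♯ additive rank-one rows — the landing socket of
the Eisenstein-congruence cards of crux KS′.  CONDITIONAL on all four antecedents; LOW₀ and LOW₁ are OPEN at `p² ∣ N`; nothing is booked.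
[cite: JetchevSkinnerWan2017, §7.4.1 (eq:shalowerK-1), §7.4.3] [cite: McCallumLMS1991, §5 Cor. 5.6 (p. 310)] [cite: WZhang2014, Thm. 1.1, Remark 5] -/
theorem kolyvaginPrimitiveAdditive_of_lowerHalves (hPub : PublishedInputsAdditiveKoly)
    (hMc : McCallum1991_padicValNat_card_sha_primary_add_le_of_globalDivisibility)
    (h₀ : ∀ (W : WeierstrassCurve ℚ) [W.IsElliptic] [W.IsGloballyMinimal] (p : ℕ) [Fact p.Prime],
      ¬ W.HasCM → 5 ≤ p → Addv W p → W.analyticRank = 0 → Typed.MissingLowerBoundAt W p)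
    (h₁ : ∀ (W : WeierstrassCurve ℚ) [W.IsElliptic] [W.IsGloballyMinimal] (p : ℕ) [Fact p.Prime],
      ¬ W.HasCM → 5 ≤ p → Addv W p → W.analyticRank = 1 → W.HasSurjectiveModNGaloisRep p →
      (∀ (ℓ : ℕ) [Fact ℓ.Prime], W.HasMultiplicativeReductionAtPrime ℓ →
        ¬ p ∣ padicValInt ℓ W.minimalDiscriminantInt) →
      (∃ (ℓ₁ ℓ₂ : ℕ) (_ : Fact ℓ₁.Prime) (_ : Fact ℓ₂.Prime), ℓ₁ ≠ ℓ₂ ∧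
        W.HasMultiplicativeReductionAtPrime ℓ₁ ∧ W.HasMultiplicativeReductionAtPrime ℓ₂) →
      ¬ p ∣ W.tamagawaProduct → Typed.MissingLowerBoundAt W p) :
    KolyvaginPrimitiveAdditive := by
  intro W _ _ _ p _ K _ _ Dt β ι hp5 hadd hs hsp htwo htam hr hK hodd hlt hH hL hβ hc
  obtain ⟨hGZ, hKo, hKoB, hGZK, hmod, -⟩ := hPub
  -- non-CM from a multiplicative prime
  obtain ⟨ℓ₁, ℓ₂, hℓ₁, hℓ₂, hne, hm₁, hm₂⟩ := htwo
  have hCM : ¬ W.HasCM := not_hasCM_of_hasMultiplicativeReductionAtPrime' W hm₁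
  -- the lower half at this ♯ rank-one row, and at every minimal model of the twist (a non-CM additive rank-zero row)
  have hlow : Typed.MissingLowerBoundAt W p :=
    h₁ W p hCM hp5 hadd hr hs hsp ⟨ℓ₁, ℓ₂, hℓ₁, hℓ₂, hne, hm₁, hm₂⟩ htam
  have hlowTw : ∀ (Wd : WeierstrassCurve ℚ) [Wd.IsElliptic] [Wd.IsGloballyMinimal] (Cd : VariableChange ℚ),
      Cd • W.quadraticTwist (NumberField.discr K : ℚ) = Wd → Typed.MissingLowerBoundAt Wd p := by
    intro Wd _ _ Cd hWd
    obtain ⟨hCMd, haddd, hrd⟩ :=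
      AdditiveKolyvaginKernel.twist_nonCM_addv_rankZero hmod W p hCM hadd K hK hH hL Wd Cd hWd
    exact h₀ Wd p hCMd hp5 haddd hrd
  exact exists_kolyvaginClass_ne_zero_of_lowerHalves W p K Dt β ι (hGZ _ W K) (hKo _ W K) (hKoB _ W K) hGZK
    hmod hMc hp5 hadd hs hCM htam hr hK hodd hlt hH hL hβ hc hlow hlowTw

/-! ## §3 The same for THIS crux: `PUB → McCallum → LOW₀ → LOW₁ → KS′` -/

/-- **CRUX r8 `LevelKolyvaginSystemsAdditive` (item stmt-BirchSwinnertonDyer-21396) FROM THE LOWER HALVES OF `BSD_p` OVER `ℚ`**: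
§2 followed by akr-p2x-w4's input-free door `levelKolyvaginSystemsAdditive_of_kolyvaginPrimitiveAdditive_free` (KPA′ → KS′ at the
Poitou–Tate THEOREM).  Same four antecedents (PUB, McCallum's divisibility half, LOW₀, LOW₁); nothing is booked; KS′ stays OPEN.
[cite: WZhang2014, Thm. 1.1, Thm. 4.3, §9] [cite: JetchevSkinnerWan2017, §7.4.1] [cite: McCallumLMS1991, §5 Cor. 5.6] -/
theorem levelKolyvaginSystemsAdditive_of_lowerHalves (hPub : PublishedInputsAdditiveKoly)
    (hMc : McCallum1991_padicValNat_card_sha_primary_add_le_of_globalDivisibility)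
    (h₀ : ∀ (W : WeierstrassCurve ℚ) [W.IsElliptic] [W.IsGloballyMinimal] (p : ℕ) [Fact p.Prime],
      ¬ W.HasCM → 5 ≤ p → Addv W p → W.analyticRank = 0 → Typed.MissingLowerBoundAt W p)
    (h₁ : ∀ (W : WeierstrassCurve ℚ) [W.IsElliptic] [W.IsGloballyMinimal] (p : ℕ) [Fact p.Prime],
      ¬ W.HasCM → 5 ≤ p → Addv W p → W.analyticRank = 1 → W.HasSurjectiveModNGaloisRep p →
      (∀ (ℓ : ℕ) [Fact ℓ.Prime], W.HasMultiplicativeReductionAtPrime ℓ →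
        ¬ p ∣ padicValInt ℓ W.minimalDiscriminantInt) →
      (∃ (ℓ₁ ℓ₂ : ℕ) (_ : Fact ℓ₁.Prime) (_ : Fact ℓ₂.Prime), ℓ₁ ≠ ℓ₂ ∧
        W.HasMultiplicativeReductionAtPrime ℓ₁ ∧ W.HasMultiplicativeReductionAtPrime ℓ₂) →
      ¬ p ∣ W.tamagawaProduct → Typed.MissingLowerBoundAt W p) :
    LevelKolyvaginSystemsAdditive :=
  levelKolyvaginSystemsAdditive_of_kolyvaginPrimitiveAdditive_free
    (kolyvaginPrimitiveAdditive_of_lowerHalves hPub hMc h₀ h₁)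

end Summit.BirchSwinnertonDyer.BirchSwinnertonDyer.Theorems.AdditiveKoly

end
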